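import Summits.BirchSwinnertonDyer.BirchSwinnertonDyer.Theorems.SemiOrdinaryEisensteinDescentWildKolyvaginUpperAtThreeTowerFreeBeyondMax
import Summits.BirchSwinnertonDyer.BirchSwinnertonDyer.Theorems.SemiOrdinaryEisensteinDescentWildKolyvaginUpperAtThreeTowerFreeJetchevMaxModThree
import HarnessLib

/-!
# Route `SemiOrdinaryEisensteinDescent`, crux of record Ko′ `WildKolyvaginUpperAtThreeTowerFree` (stmt-BirchSwinnertonDyer-24696):
# Ko′ and J′ BY NAME from the FOUR PRINT primitives + the depth residue J⁗♭ («beyond the max») + ManinScaling₃ — no displayed tree debt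
# (cell `bsd-wall`, width seat `bsd-wall-soed-p2-w3` gen 2; `--supports stmt-BirchSwinnertonDyer-24696`, helper; BSD is not proved by this file)

This file composes two helpers that landed minutes apart:
* p606966 (this seat) `…TowerFreeBeyondMax`: Ko′ BY NAME ⟸ {CT, 3.7 (2), E0} + `hJmax` (Jetchev's max-form at `3 ∣ N` under
  `ρ̄₃` onto, DISPLAYED) + J⁗♭ (J′'s text + `¬ 3 ∣ c(Dt)` + ONE depth binder «every single carrier `ord₃ c_q < s′`») +
  ManinScaling₃; and J′ BY NAME ⟸ `hJmax` + J⁗;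
* p606426 (width seat w2 g5) `…TowerFreeJetchevMaxModThree.jetchevMaxModThree_of_literature`: `hJmax` ⟸ (PT)
  `poitouTate_selmerStructure_duality_conj`, (F1 = E0) `Gross1991_heegnerPoint_sub_ratTorsion_mem_E0`, (3.7 (2))
  `GrossLMS1991.prop37_2_frobeniusCongruence` — the tower→mod-`3` twin of the `bsd-jet` road-K kernel.
Result: the displayed tree debt `hJmax` is gone from the depth road. In the kernel, **Ko′ BY NAME ⟸ {CT, 3.7 (2), E0, PT} (print,
Literature named facts) + J⁗♭ (research: `3^{s′} ∣ P(n)` exactly for `max_q ord₃ c_q < s′ ≤ Σ_q ord₃ c_q`, `3 ∤ c` — Büyükboduk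
2009 §4.2 Question 1 at the additive prime `3`) + ManinScaling₃ (research: the `3`-part of Manin's conjecture at `27 ∣ N`)**, and
**J′ BY NAME ⟸ {PT, E0, 3.7 (2)} + J⁗** (depth form with the Manin term kept inside). Compare w2 g5's frame-form twin
`…JetchevMaxModThree.wildKolyvaginUpperAtThreeTowerFree_of_flatMultiCarrier_of_maninScaling_of_fourPrimitives` (J′♭ on ≥ 2 Tamagawa
carriers, all depths): the depth form asks nothing that Jetchev's max already gives (`…BeyondMax.beyondMax_of_sigmaMultiCarrier`).

HONEST FRAMING. CONDITIONAL theorems: four Literature named facts as hypotheses (print, undischarged in the tree), two research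
hypotheses (J⁗♭ / J⁗, ManinScaling₃). No definition, no named fact, no `sorry`; nothing about any curve is asserted; Ko′, J′, Manin's
conjecture and BSD stay open. BSD is not proved by this file.

References: [Jetchev2008] Thm. 1.4, Cor. 1.5, Conj. 1.3 (p. 812); [Buyukboduk2009TamagawaDefect] §4.2 Question 1; [McCallumLMS1991]
§5 Cor. 5.6 (p. 310); [GrossLMS1991] Prop. 3.7 (2), §6; [MilneADT2006] I §6; [CesnaviciusNeururerSaha2023] Thm. 1.2.
-/

set_option autoImplicit false
set_option linter.dupNamespace false -- `Summit.BirchSwinnertonDyer.BirchSwinnertonDyer.…` is the tree's layout (D-0017)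

noncomputable section

open scoped Classical

namespace Summit.BirchSwinnertonDyer.BirchSwinnertonDyer.Theorems.WildKolyvaginUpperAtThreeTowerFreeBeyondMaxOfPrint

open WeierstrassCurve NumberField Literature.NumberTheory.EllipticCurves
  Literature.NumberTheory.EllipticCurves.ModularForms
  Literature.NumberTheory.GaloisCohomology
  Summit.BirchSwinnertonDyer.Rank1Residual
  Summit.BirchSwinnertonDyer.Rank1Residual.Additive
  Summit.BirchSwinnertonDyer.Rank1Residual.X11b.Three
  Summit.BirchSwinnertonDyer.BirchSwinnertonDyer.Theses.SemiOrdinaryEisensteinDescent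
  Summit.BirchSwinnertonDyer.BirchSwinnertonDyer.Theorems.WildKolyvaginUpperAtThreeTowerFreeBeyondMax
  Summit.BirchSwinnertonDyer.BirchSwinnertonDyer.Theorems.WildKolyvaginUpperAtThreeTowerFreeJetchevMaxModThree
open Literature.NumberTheory.EllipticCurves.GrossLMS1991 (prop37_2_frobeniusCongruence)

/-- **J′ `WildSigmaDivisibilityAtThreeTowerFree` (stmt-24702) BY NAME ⟸ {(PT), (E0), (3.7 (2))} + J⁗** (`hJb`: J′'s text + ONE
depth binder «`∀ q` prime `∣ N, ord₃ c_q(E/ℚ_q) < s′`», Manin term kept inside the depth). = `…BeyondMax.sigmaTowerFree_of_beyondMax_of_jetchevMax`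
with `hJmax := jetchevMaxModThree_of_literature hPT hE0 h372` (p606426). CONDITIONAL on the three named facts and on `hJb` (open
research); nothing about any curve is asserted. [cite: Jetchev2008, Thm. 1.4 and Conj. 1.3 (p. 812)]
[cite: Buyukboduk2009TamagawaDefect, §4.2 Question 1] [cite: GrossLMS1991, Prop. 3.7 (2)] -/
theorem wildSigmaDivisibilityAtThreeTowerFree_of_beyondMax_of_threePrintFacts
    (hPT : ∀ (K : Type) [Field K] [NumberField K], poitouTate_selmerStructure_duality_conj K)
    (hE0 : Gross1991_heegnerPoint_sub_ratTorsion_mem_E0) (h372 : prop37_2_frobeniusCongruence)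
    (hJb : ∀ (W : WeierstrassCurve ℚ) [W.IsElliptic] [W.IsGloballyMinimal] (N : ℕ) [NeZero N] (K : Type)
      [Field K] [NumberField K] (Dt : ModularParametrizationData W N)
      (H : HeegnerDatum N (NumberField.discr K)) (ι : K →+* ℂ) (P : (W.baseChange K).toAffine.Point),
      ClassO6 W 3 → W.HasSurjectiveModNGaloisRep 3 → W.analyticRank = 1 → W.conductorNorm ℤ = N →
      IsImaginaryQuadratic K → SatisfiesHeegnerHypothesis N K →
      (W.quadraticTwist (NumberField.discr K : ℚ)).entireLFunction 1 ≠ 0 →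
      WeierstrassCurve.Affine.Point.map ι.toRatAlgHom P = heegnerPointComplex Dt H →
      ¬ IsOfFinAddOrder P → Odd (NumberField.discr K) → NumberField.discr K ≠ -3 →
      ∀ (s' : ℕ), (∀ (q : ℕ) [Fact q.Prime], q ∣ N →
        padicValNat 3 ((W.baseChange ℚ_[q]).localTamagawaNumber ℤ_[q]) < s') →
      s' ≤ padicValNat 3 W.tamagawaProduct + padicValNat 3 Dt.c.natAbs →
        ∀ (n : ℕ) (d : KolyvaginHeegnerData Dt H.β ι n), Squarefree n →
          (∀ ℓ ∈ n.primeFactors, Zhang2014.IsKolyvaginPrime N W K 3 ℓ ∧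
            s' ≤ Zhang2014.kolyvaginIndex W 3 ℓ) → Koly.PDiv d 3 s') :
    WildSigmaDivisibilityAtThreeTowerFree :=
  sigmaTowerFree_of_beyondMax_of_jetchevMax (jetchevMaxModThree_of_literature hPT hE0 h372) hJb

/-- **Crux of record Ko′ `WildKolyvaginUpperAtThreeTowerFree` (stmt-24696) BY NAME ⟸ the FOUR PRINT primitives {`∀ K,
casselsTate_levelInputs K`, Gross 1991 Prop. 3.7 (2), GZ86 III (3.1) = E0, `∀ K, poitouTate_selmerStructure_duality_conj K`} +
J⁗** (`hJb`, depth form with the Manin term inside). = `…BeyondMax.wildKolyvaginUpperAtThreeTowerFree_of_beyondMax_of_jetchevMax_of_threePrimitives`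
with `hJmax` discharged by p606426. CONDITIONAL on the four named facts and on `hJb` (open research: Büyükboduk 2009 §4.2 Q1 at the
additive prime `3` ⊕ the Manin₃ shadow); Ko′, J′ and BSD stay open. [cite: McCallumLMS1991, §5 Cor. 5.6 (p. 310)]
[cite: Jetchev2008, Thm. 1.4 and Conj. 1.3 (p. 812)] [cite: Buyukboduk2009TamagawaDefect, §4.2 Question 1] -/
theorem wildKolyvaginUpperAtThreeTowerFree_of_beyondMax_of_fourPrimitives
    (hCT : ∀ (K : Type) [Field K] [NumberField K], casselsTate_levelInputs K)
    (h372 : prop37_2_frobeniusCongruence) (hE0 : Gross1991_heegnerPoint_sub_ratTorsion_mem_E0)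
    (hPT : ∀ (K : Type) [Field K] [NumberField K], poitouTate_selmerStructure_duality_conj K)
    (hJb : ∀ (W : WeierstrassCurve ℚ) [W.IsElliptic] [W.IsGloballyMinimal] (N : ℕ) [NeZero N] (K : Type)
      [Field K] [NumberField K] (Dt : ModularParametrizationData W N)
      (H : HeegnerDatum N (NumberField.discr K)) (ι : K →+* ℂ) (P : (W.baseChange K).toAffine.Point),
      ClassO6 W 3 → W.HasSurjectiveModNGaloisRep 3 → W.analyticRank = 1 → W.conductorNorm ℤ = N →
      IsImaginaryQuadratic K → SatisfiesHeegnerHypothesis N K →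
      (W.quadraticTwist (NumberField.discr K : ℚ)).entireLFunction 1 ≠ 0 →
      WeierstrassCurve.Affine.Point.map ι.toRatAlgHom P = heegnerPointComplex Dt H →
      ¬ IsOfFinAddOrder P → Odd (NumberField.discr K) → NumberField.discr K ≠ -3 →
      ∀ (s' : ℕ), (∀ (q : ℕ) [Fact q.Prime], q ∣ N →
        padicValNat 3 ((W.baseChange ℚ_[q]).localTamagawaNumber ℤ_[q]) < s') →
      s' ≤ padicValNat 3 W.tamagawaProduct + padicValNat 3 Dt.c.natAbs →
        ∀ (n : ℕ) (d : KolyvaginHeegnerData Dt H.β ι n), Squarefree n →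
          (∀ ℓ ∈ n.primeFactors, Zhang2014.IsKolyvaginPrime N W K 3 ℓ ∧
            s' ≤ Zhang2014.kolyvaginIndex W 3 ℓ) → Koly.PDiv d 3 s') :
    WildKolyvaginUpperAtThreeTowerFree :=
  wildKolyvaginUpperAtThreeTowerFree_of_beyondMax_of_jetchevMax_of_threePrimitives hCT h372 hE0
    (jetchevMaxModThree_of_literature hPT hE0 h372) hJb

/-- **Crux of record Ko′ `WildKolyvaginUpperAtThreeTowerFree` (stmt-24696) BY NAME ⟸ the FOUR PRINT primitives {CT, 3.7 (2), E0,
PT} + J⁗♭ (`hFlatB`: `3^{s′} ∣ P(n)` exactly for `max_q ord₃ c_q < s′ ≤ Σ_q ord₃ c_q` on data with `3 ∤ c`) + ManinScaling₃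
(`hScal`).** = `…BeyondMax.wildKolyvaginUpperAtThreeTowerFree_of_flatBeyondMax_of_maninScaling_of_jetchevMax_of_threePrimitives` with
`hJmax` discharged by p606426 — the Ko′ column's closer modulo EXACTLY {four print facts, Büyükboduk 2009 §4.2 Q1 at the additive
prime `3`, Manin₃}. CONDITIONAL on all six displayed hypotheses; Ko′, J′, Manin's conjecture and BSD stay open.
[cite: McCallumLMS1991, §5 Cor. 5.6 (p. 310)] [cite: Jetchev2008, Thm. 1.4 and Conj. 1.3 (p. 812)]
[cite: Buyukboduk2009TamagawaDefect, §4.2 Question 1] [cite: CesnaviciusNeururerSaha2023, Thm. 1.2] -/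
theorem wildKolyvaginUpperAtThreeTowerFree_of_flatBeyondMax_of_maninScaling_of_fourPrimitives
    (hCT : ∀ (K : Type) [Field K] [NumberField K], casselsTate_levelInputs K)
    (h372 : prop37_2_frobeniusCongruence) (hE0 : Gross1991_heegnerPoint_sub_ratTorsion_mem_E0)
    (hPT : ∀ (K : Type) [Field K] [NumberField K], poitouTate_selmerStructure_duality_conj K)
    (hFlatB : ∀ (W : WeierstrassCurve ℚ) [W.IsElliptic] [W.IsGloballyMinimal] (N : ℕ) [NeZero N] (K : Type)
      [Field K] [NumberField K] (Dt : ModularParametrizationData W N)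
      (H : HeegnerDatum N (NumberField.discr K)) (ι : K →+* ℂ) (P : (W.baseChange K).toAffine.Point),
      ClassO6 W 3 → W.HasSurjectiveModNGaloisRep 3 → W.analyticRank = 1 → W.conductorNorm ℤ = N →
      IsImaginaryQuadratic K → SatisfiesHeegnerHypothesis N K →
      (W.quadraticTwist (NumberField.discr K : ℚ)).entireLFunction 1 ≠ 0 →
      WeierstrassCurve.Affine.Point.map ι.toRatAlgHom P = heegnerPointComplex Dt H →
      ¬ IsOfFinAddOrder P → Odd (NumberField.discr K) → NumberField.discr K ≠ -3 →
      ¬ (3 : ℤ) ∣ Dt.c →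
      ∀ (s' : ℕ), (∀ (q : ℕ) [Fact q.Prime], q ∣ N →
        padicValNat 3 ((W.baseChange ℚ_[q]).localTamagawaNumber ℤ_[q]) < s') →
      s' ≤ padicValNat 3 W.tamagawaProduct + padicValNat 3 Dt.c.natAbs →
        ∀ (n : ℕ) (d : KolyvaginHeegnerData Dt H.β ι n), Squarefree n →
          (∀ ℓ ∈ n.primeFactors, Zhang2014.IsKolyvaginPrime N W K 3 ℓ ∧
            s' ≤ Zhang2014.kolyvaginIndex W 3 ℓ) → Koly.PDiv d 3 s')
    (hScal : ∀ (W : WeierstrassCurve ℚ) [W.IsElliptic] [W.IsGloballyMinimal] (N : ℕ) [NeZero N],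
      ClassO6 W 3 → W.HasSurjectiveModNGaloisRep 3 → W.analyticRank = 1 → W.conductorNorm ℤ = N →
      ∀ (Dt : ModularParametrizationData W N), ∃ (Dt' : ModularParametrizationData W N) (k : ℤ),
        Dt'.f = Dt.f ∧ Dt'.uniformize = Dt.uniformize ∧ Dt.c = k * Dt'.c ∧ ¬ (3 : ℤ) ∣ Dt'.c) :
    WildKolyvaginUpperAtThreeTowerFree :=
  wildKolyvaginUpperAtThreeTowerFree_of_flatBeyondMax_of_maninScaling_of_jetchevMax_of_threePrimitives hCT h372 hE0
    (jetchevMaxModThree_of_literature hPT hE0 h372) hFlatB hScal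

end Summit.BirchSwinnertonDyer.BirchSwinnertonDyer.Theorems.WildKolyvaginUpperAtThreeTowerFreeBeyondMaxOfPrint

end
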